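import Summits.CriticalPhenomena.CardyFormulaZ2.Theses.CardySelfRefinement
import Summits.CriticalPhenomena.CardyFormulaZ2.Theorems.CardySelfRefinementLagHandOffDiscreteSplittingPatch
import Literature.Probability.LatticeModels.MeshDomainBigComponents
import Literature.Probability.Percolation.BoxCrossingProofs
import HarnessLib

/-!
# Lattice locality for nested domains: helper for stub `stub_discreteLocality` (R3a) of line
`hitting-tournament` for crux `LagHandOff` (stmt-CriticalPhenomena-10268)

Let `Ω' ⊆ Ω` be two planar domains and `F = closure (Ω ∖ Ω')` the removed part, so that
`closure Ω = closure Ω' ∪ F`.  At a lattice site `x` whose mesh point is farther than a few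
meshes from `F`, the canonical discretisations `Ω_δ = meshDomain Ω δ` and `Ω'_δ` look the same:

* (deterministic) mesh vertices and mesh-graph edges at `x` agree (`mem_meshVertices_iff_of_far`,
  `meshGraph_adj_iff_of_far`); if moreover `x ∈ Ω_δ ∩ Ω'_δ` then the edges of the two domain
  graphs at `x`, the inner faces at `x`, the face-boundary edges at `x` and membership of `x` in
  the vertex boundary and in the square-lattice boundary `zdBoundary` agree
  (`discreteDomainGraph_adj_iff_of_far`, `isInnerFace_iff_of_far`, `mem_zdBoundary_iff_of_far`);
* (for all small meshes, Jordan domains) `Ω'_δ ⊆ Ω_δ` (`eventually_meshDomain_inner_subset`) and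
  every site of `Ω_δ` at distance `≥ θ` from `F` lies in `Ω'_δ` (`eventually_mem_inner_of_far`):
  the largest-component discretisation is the bulk (`MeshDomainJordan.lean`) and macroscopic
  components are the bulk (`MeshDomainBigComponents.lean`).
-/

noncomputable section

open Set Filter Topology Metric
open Literature.Probability.LatticeModels Literature.Probability.Percolation
  Literature.Probability.RandomPlanarGeometry
open Summit.CriticalPhenomena.CardyFormulaZ2.Theorems.DiscretisationFamilyExists

namespace Summit.CriticalPhenomena.CardyFormulaZ2.Cruxes.LagHandOff.HittingTournament

section Deterministic

variable {Ω Ω' : Set ℂ} {δ : ℝ}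

/-! ### Plane topology of the removed part -/

/-- The closure of the big domain is covered by the closure of the small one and the removed
part `closure (Ω ∖ Ω')`. -/
theorem closure_subset_closure_union_closure_diff (Ω Ω' : Set ℂ) :
    closure Ω ⊆ closure Ω' ∪ closure (Ω \ Ω') := by
  rw [← closure_union]
  exact closure_mono fun z hz => (em (z ∈ Ω')).imp id fun h => ⟨hz, h⟩

/-- A point of the big domain off the removed part lies in the small domain. -/
theorem mem_inner_of_not_mem_closure_diff {z : ℂ} (hz : z ∈ Ω) (hzF : z ∉ closure (Ω \ Ω')) :
    z ∈ Ω' :=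
  by_contra fun h => hzF (subset_closure ⟨hz, h⟩)

/-- A point at distance less than `infDist z F` from `z` is off `F`. -/
theorem not_mem_of_dist_lt_infDist {F : Set ℂ} {z w : ℂ} (h : dist w z < infDist z F) : w ∉ F := fun hw => by
  have := infDist_le_dist_of_mem (x := z) hw
  rw [dist_comm] at h
  linarith

/-- Distances to a set are `1`-Lipschitz: a point within `r` of `z` is at distance at least
`infDist z F - r` from `F`. -/
theorem infDist_sub_le_of_dist_le {F : Set ℂ} {z w : ℂ} {r : ℝ} (h : dist w z ≤ r) :
    infDist z F - r ≤ infDist w F := by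
  have := infDist_le_infDist_add_dist (s := F) (x := z) (y := w)
  rw [dist_comm] at h
  linarith

/-! ### Mesh vertices and mesh edges far from the removed part -/

/-- Far from the removed part, the two domains have the same mesh vertices. -/
theorem mem_meshVertices_iff_of_far (hsub : Ω' ⊆ Ω) {x : Site 2}
    (hx : 0 < infDist (meshPoint δ x) (closure (Ω \ Ω'))) :
    x ∈ meshVertices Ω δ ↔ x ∈ meshVertices Ω' δ := by
  rw [mem_meshVertices_iff, mem_meshVertices_iff]
  refine ⟨fun h => mem_inner_of_not_mem_closure_diff h ?_, fun h => hsub h⟩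
  exact not_mem_of_dist_lt_infDist (by rw [dist_self]; exact hx)

/-- Lattice neighbours are one mesh apart. -/
theorem dist_meshPoint_of_zdGraph_adj (hδ : 0 ≤ δ) {x y : Site 2} (h : (zdGraph 2).Adj x y) :
    dist (meshPoint δ y) (meshPoint δ x) = δ := by
  obtain ⟨k, rfl⟩ := exists_eq_add_cornerUnit h
  rw [dist_eq_norm, meshPoint_add, add_sub_cancel_left, norm_meshPoint_cornerUnit, abs_of_nonneg hδ]

/-- Far from the removed part (more than one mesh), the two domains have the same mesh edges. -/
theorem meshGraph_adj_iff_of_far (hsub : Ω' ⊆ Ω) (hδ : 0 ≤ δ) {x y : Site 2}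
    (hx : δ < infDist (meshPoint δ x) (closure (Ω \ Ω'))) :
    (meshGraph Ω δ).Adj x y ↔ (meshGraph Ω' δ).Adj x y := by
  rw [meshGraph_adj_iff, meshGraph_adj_iff]
  refine ⟨fun ⟨hzd, hseg⟩ => ⟨hzd, fun w hw => ?_⟩, fun ⟨hzd, hseg⟩ => ⟨hzd, hseg.trans (closure_mono hsub)⟩⟩
  have hwB : w ∈ closedBall (meshPoint δ x) δ :=
    (convex_closedBall _ _).segment_subset (mem_closedBall_self hδ)
      (by rw [mem_closedBall, dist_meshPoint_of_zdGraph_adj hδ hzd]) hw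
  rcases closure_subset_closure_union_closure_diff Ω Ω' (hseg hw) with h | h
  · exact h
  · exact absurd h (not_mem_of_dist_lt_infDist ((mem_closedBall.1 hwB).trans_lt hx))

/-! ### The domain graphs, inner faces and boundaries at a common far site -/

/-- Far from the removed part, at a site of both discrete domains, the two domain graphs have the
same edges. -/
theorem discreteDomainGraph_adj_iff_of_far (hsub : Ω' ⊆ Ω) (hδ : 0 ≤ δ) {x y : Site 2}
    (hx : δ < infDist (meshPoint δ x) (closure (Ω \ Ω')))
    (hxM : x ∈ meshDomain Ω δ) (hxM' : x ∈ meshDomain Ω' δ) :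
    (discreteDomainGraph Ω δ).Adj x y ↔ (discreteDomainGraph Ω' δ).Adj x y := by
  rw [discreteDomainGraph_adj_iff, discreteDomainGraph_adj_iff]
  constructor
  · rintro ⟨hm, -, hyM⟩
    have hm' := (meshGraph_adj_iff_of_far hsub hδ hx).1 hm
    have hyV : y ∈ meshVertices Ω' δ := by
      refine (mem_meshVertices_iff_of_far hsub ?_).1 (meshDomain_subset_meshVertices _ _ hyM)
      have := infDist_sub_le_of_dist_le (F := closure (Ω \ Ω'))
        (dist_meshPoint_of_zdGraph_adj hδ (meshGraph_le_zdGraph _ _ hm)).le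
      linarith
    exact ⟨hm', hxM', mem_meshDomain_of_meshGraph_adj hxM' hyV hm'⟩
  · rintro ⟨hm', -, hyM'⟩
    have hm := (meshGraph_adj_iff_of_far hsub hδ hx).2 hm'
    exact ⟨hm, hxM, mem_meshDomain_of_meshGraph_adj hxM
      (hsub (meshDomain_subset_meshVertices _ _ hyM' :)) hm⟩

/-- **Transfer of inner faces.** If the mesh edges and mesh vertices among the corners of a face
`f` of `Ω₁` are mesh edges and vertices of `Ω₂`, and one corner of `f` lies in `(Ω₂)_δ`, then `f`
inner for `Ω₁` is inner for `Ω₂` (all its corners are joined to that corner along sides). -/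
theorem isInnerFace_transfer {Ω₁ Ω₂ : Set ℂ} {A₁ B₁ A₂ B₂ : Set ℂ} {f : Site 2}
    (hadj : ∀ v w, IsCorner v f → IsCorner w f → (meshGraph Ω₁ δ).Adj v w → (meshGraph Ω₂ δ).Adj v w)
    (hvert : ∀ v, IsCorner v f → v ∈ meshVertices Ω₁ δ → v ∈ meshVertices Ω₂ δ)
    {x : Site 2} (hx : IsCorner x f) (hxM : x ∈ meshDomain Ω₂ δ)
    (hf : (⟨Ω₁, δ, A₁, B₁⟩ : DiscreteDobrushin).IsInnerFace f) :
    (⟨Ω₂, δ, A₂, B₂⟩ : DiscreteDobrushin).IsInnerFace f := by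
  -- one step along a side of `f` inside `(Ω₂)_δ`
  have step : ∀ {v w : Site 2}, IsCorner v f → IsCorner w f → (zdGraph 2).Adj v w →
      v ∈ meshDomain Ω₂ δ → w ∈ meshDomain Ω₂ δ := by
    intro v w hv hw hvw hvM
    have h := discreteDomainGraph_adj_iff.1 (hf v w hv hw hvw)
    exact mem_meshDomain_of_meshGraph_adj hvM (hvert w hw (meshDomain_subset_meshVertices _ _ h.2.2))
      (hadj v w hv hw h.1)
  -- the four corners and their adjacencies
  have k0 : IsCorner f f := (Literature.Probability.LatticeModels.isCorner_iff _ _).2 (Or.inl rfl)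
  have k1 : IsCorner (f + Pi.single 0 1) f :=
    (Literature.Probability.LatticeModels.isCorner_iff _ _).2 (Or.inr (Or.inl rfl))
  have k2 : IsCorner (f + Pi.single 1 1) f :=
    (Literature.Probability.LatticeModels.isCorner_iff _ _).2 (Or.inr (Or.inr (Or.inl rfl)))
  have k3 : IsCorner (f + Pi.single 0 1 + Pi.single 1 1) f :=
    (Literature.Probability.LatticeModels.isCorner_iff _ _).2 (Or.inr (Or.inr (Or.inr rfl)))
  have a01 : (zdGraph 2).Adj f (f + Pi.single 0 1) := (SimpleGraph.mem_edgeSet _).1 (cSrc_mem_edgeSet (f, 0))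
  have a02 : (zdGraph 2).Adj f (f + Pi.single 1 1) := (SimpleGraph.mem_edgeSet _).1 (cSrc_mem_edgeSet (f, 1))
  have a13 : (zdGraph 2).Adj (f + Pi.single 0 1) (f + Pi.single 0 1 + Pi.single 1 1) :=
    (SimpleGraph.mem_edgeSet _).1 (cSrc_mem_edgeSet (f + Pi.single 0 1, 1))
  have a23 : (zdGraph 2).Adj (f + Pi.single 1 1) (f + Pi.single 0 1 + Pi.single 1 1) := by
    have h := (SimpleGraph.mem_edgeSet _).1 (cSrc_mem_edgeSet (f + Pi.single 1 1, 0))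
    rw [add_right_comm]
    exact h
  -- all corners lie in `(Ω₂)_δ`
  have hall : ∀ v, IsCorner v f → v ∈ meshDomain Ω₂ δ := by
    have hfour : f ∈ meshDomain Ω₂ δ ∧ f + Pi.single 0 1 ∈ meshDomain Ω₂ δ ∧
        f + Pi.single 1 1 ∈ meshDomain Ω₂ δ ∧ f + Pi.single 0 1 + Pi.single 1 1 ∈ meshDomain Ω₂ δ := by
      rcases (Literature.Probability.LatticeModels.isCorner_iff _ _).1 hx with h | h | h | h <;> rw [h] at hxM
      · have h1 := step k0 k1 a01 hxM
        exact ⟨hxM, h1, step k0 k2 a02 hxM, step k1 k3 a13 h1⟩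
      · have h0 := step k1 k0 a01.symm hxM
        exact ⟨h0, hxM, step k0 k2 a02 h0, step k1 k3 a13 hxM⟩
      · have h0 := step k2 k0 a02.symm hxM
        exact ⟨h0, step k0 k1 a01 h0, hxM, step k2 k3 a23 hxM⟩
      · have h1 := step k3 k1 a13.symm hxM
        have h0 := step k1 k0 a01.symm h1
        exact ⟨h0, h1, step k0 k2 a02 h0, hxM⟩
    intro v hv
    rcases (Literature.Probability.LatticeModels.isCorner_iff _ _).1 hv with rfl | rfl | rfl | rfl
    · exact hfour.1
    · exact hfour.2.1
    · exact hfour.2.2.1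
    · exact hfour.2.2.2
  intro v w hv hw hvw
  have h := discreteDomainGraph_adj_iff.1 (hf v w hv hw hvw)
  exact discreteDomainGraph_adj_iff.2 ⟨hadj v w hv hw h.1, hall v hv, hall w hw⟩

/-- Far from the removed part (more than three meshes), at a corner lying in both discrete
domains, a face is inner for `Ω` iff it is inner for `Ω'`. -/
theorem isInnerFace_iff_of_far (hsub : Ω' ⊆ Ω) (hδ : 0 ≤ δ) {A B A' B' : Set ℂ} {x f : Site 2}
    (hxf : IsCorner x f) (hx : 3 * δ < infDist (meshPoint δ x) (closure (Ω \ Ω')))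
    (hxM : x ∈ meshDomain Ω δ) (hxM' : x ∈ meshDomain Ω' δ) :
    (⟨Ω, δ, A, B⟩ : DiscreteDobrushin).IsInnerFace f ↔ (⟨Ω', δ, A', B'⟩ : DiscreteDobrushin).IsInnerFace f := by
  -- every corner of `f` is more than one mesh from the removed part
  have hfar : ∀ v, IsCorner v f → δ < infDist (meshPoint δ v) (closure (Ω \ Ω')) := by
    intro v hv
    have hd := dist_corner_corner_le hδ hv hxf
    have hs : Real.sqrt 2 ≤ 2 := by
      rw [Real.sqrt_le_left (by norm_num)]; norm_num
    have hd2 : dist (meshPoint δ v) (meshPoint δ x) ≤ 2 * δ := hd.trans (by nlinarith)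
    have := infDist_sub_le_of_dist_le (F := closure (Ω \ Ω')) hd2
    linarith
  constructor
  · exact isInnerFace_transfer (fun v w hv _ h => (meshGraph_adj_iff_of_far hsub hδ (hfar v hv)).1 h)
      (fun v hv h => (mem_meshVertices_iff_of_far hsub ((hfar v hv).trans_le' hδ)).1 h) hxf hxM'
  · exact isInnerFace_transfer (fun v w hv _ h => (meshGraph_adj_iff_of_far hsub hδ (hfar v hv)).2 h)
      (fun v _ h => hsub (h :)) hxf hxM

/-- Far from the removed part, at a site of both discrete domains, face-boundary edges agree. -/
theorem isFaceBoundaryEdge_iff_of_far (hsub : Ω' ⊆ Ω) (hδ : 0 ≤ δ) {A B A' B' : Set ℂ} {x y : Site 2}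
    (hx : 3 * δ < infDist (meshPoint δ x) (closure (Ω \ Ω')))
    (hxM : x ∈ meshDomain Ω δ) (hxM' : x ∈ meshDomain Ω' δ) :
    (⟨Ω, δ, A, B⟩ : DiscreteDobrushin).IsFaceBoundaryEdge x y ↔
      (⟨Ω', δ, A', B'⟩ : DiscreteDobrushin).IsFaceBoundaryEdge x y := by
  have hx1 : δ < infDist (meshPoint δ x) (closure (Ω \ Ω')) := by linarith
  have hadj := discreteDomainGraph_adj_iff_of_far hsub hδ hx1 hxM hxM' (y := y)
  have hface : ∀ f, IsCorner x f → ((⟨Ω, δ, A, B⟩ : DiscreteDobrushin).IsInnerFace f ↔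
      (⟨Ω', δ, A', B'⟩ : DiscreteDobrushin).IsInnerFace f) := fun f hf =>
    isInnerFace_iff_of_far hsub hδ hf hx hxM hxM'
  simp only [DiscreteDobrushin.IsFaceBoundaryEdge]
  constructor
  · rintro ⟨h1, ⟨f, hf, hxf, hyf⟩, ⟨g, hg, hxg, hyg⟩⟩
    exact ⟨hadj.1 h1, ⟨f, (hface f hxf).1 hf, hxf, hyf⟩, ⟨g, fun h => hg ((hface g hxg).2 h), hxg, hyg⟩⟩
  · rintro ⟨h1, ⟨f, hf, hxf, hyf⟩, ⟨g, hg, hxg, hyg⟩⟩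
    exact ⟨hadj.2 h1, ⟨f, (hface f hxf).2 hf, hxf, hyf⟩, ⟨g, fun h => hg ((hface g hxg).1 h), hxg, hyg⟩⟩

/-- Far from the removed part, at a site of both discrete domains, membership in the vertex
boundary agrees. -/
theorem mem_meshBoundary_iff_of_far (hsub : Ω' ⊆ Ω) (hδ : 0 ≤ δ) {x : Site 2}
    (hx : δ < infDist (meshPoint δ x) (closure (Ω \ Ω')))
    (hxM : x ∈ meshDomain Ω δ) (hxM' : x ∈ meshDomain Ω' δ) :
    x ∈ meshBoundary Ω δ ↔ x ∈ meshBoundary Ω' δ := by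
  simp only [mem_meshBoundary_iff]
  refine ⟨fun ⟨_, y, hy, hny⟩ => ⟨hxM', y, hy, fun h => hny ?_⟩, fun ⟨_, y, hy, hny⟩ => ⟨hxM, y, hy, fun h => hny ?_⟩⟩
  · exact (discreteDomainGraph_adj_iff_of_far hsub hδ hx hxM hxM').2 h
  · exact (discreteDomainGraph_adj_iff_of_far hsub hδ hx hxM hxM').1 h

/-- **Far from the removed part, at a site of both discrete domains, membership in the
square-lattice boundary `zdBoundary` agrees.** -/
theorem mem_zdBoundary_iff_of_far (hsub : Ω' ⊆ Ω) (hδ : 0 ≤ δ) {A B A' B' : Set ℂ} {x : Site 2}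
    (hx : 3 * δ < infDist (meshPoint δ x) (closure (Ω \ Ω')))
    (hxM : x ∈ meshDomain Ω δ) (hxM' : x ∈ meshDomain Ω' δ) :
    x ∈ (⟨Ω, δ, A, B⟩ : DiscreteDobrushin).zdBoundary ↔ x ∈ (⟨Ω', δ, A', B'⟩ : DiscreteDobrushin).zdBoundary := by
  have hx1 : δ < infDist (meshPoint δ x) (closure (Ω \ Ω')) := by linarith
  simp only [DiscreteDobrushin.mem_zdBoundary_iff]
  rw [mem_meshBoundary_iff_of_far hsub hδ hx1 hxM hxM']
  refine or_congr Iff.rfl (exists_congr fun y => ?_)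
  exact isFaceBoundaryEdge_iff_of_far hsub hδ hx hxM hxM'

/-- Far from the removed part, at a site of both discrete domains, the edges of the two domain
graphs at that site agree (edge-set form). -/
theorem mk_mem_edgeSet_iff_of_far (hsub : Ω' ⊆ Ω) (hδ : 0 ≤ δ) {x y : Site 2}
    (hx : δ < infDist (meshPoint δ x) (closure (Ω \ Ω')))
    (hxM : x ∈ meshDomain Ω δ) (hxM' : x ∈ meshDomain Ω' δ) :
    s(x, y) ∈ (discreteDomainGraph Ω δ).edgeSet ↔ s(x, y) ∈ (discreteDomainGraph Ω' δ).edgeSet := by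
  rw [SimpleGraph.mem_edgeSet, SimpleGraph.mem_edgeSet]
  exact discreteDomainGraph_adj_iff_of_far hsub hδ hx hxM hxM'

/-! ### Reaching the bulk inside the small domain -/

/-- **Walking to the bulk.** Along a walk of the mesh graph of `Ω` from `x` to a site `x₀` of
`Ω'_δ`: either `x ∈ Ω'_δ`, or `x` is joined inside the mesh graph of `Ω'` to a site within one
mesh of the removed part (the walk is followed until it first needs an edge or a vertex that
`Ω'` does not have). -/
theorem mem_or_exists_near_of_walk (hsub : Ω' ⊆ Ω) (hδ : 0 ≤ δ) {x₀ : Site 2}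
    (hx₀ : x₀ ∈ meshDomain Ω' δ) {x : meshVertices Ω δ} {y₀ : meshVertices Ω δ} (hy₀ : (y₀ : Site 2) = x₀)
    (W : (meshVertexGraph Ω δ).Walk x y₀) (hxV : (x : Site 2) ∈ meshVertices Ω' δ) :
    (x : Site 2) ∈ meshDomain Ω' δ ∨
      ∃ (y : Site 2) (hy : y ∈ meshVertices Ω' δ),
        (meshVertexGraph Ω' δ).Reachable ⟨x, hxV⟩ ⟨y, hy⟩ ∧
          infDist (meshPoint δ y) (closure (Ω \ Ω')) ≤ δ := by
  induction W with
  | nil =>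
    left
    rw [hy₀]
    exact hx₀
  | @cons u v w huv W ih =>
    by_cases hfar : δ < infDist (meshPoint δ (u : Site 2)) (closure (Ω \ Ω'))
    · -- the first edge is an edge of the mesh graph of `Ω'`
      have hm : (meshGraph Ω δ).Adj (u : Site 2) (v : Site 2) := huv
      have hm' := (meshGraph_adj_iff_of_far hsub hδ hfar).1 hm
      have hvV : (v : Site 2) ∈ meshVertices Ω' δ := by
        refine (mem_meshVertices_iff_of_far hsub ?_).1 v.2
        have := infDist_sub_le_of_dist_le (F := closure (Ω \ Ω'))
          (dist_meshPoint_of_zdGraph_adj hδ (meshGraph_le_zdGraph _ _ hm)).le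
        linarith
      have hstep : (meshVertexGraph Ω' δ).Adj ⟨u, hxV⟩ ⟨v, hvV⟩ := hm'
      rcases ih hy₀ hvV with hvM | ⟨y, hy, hreach, hnear⟩
      · exact Or.inl (mem_meshDomain_of_meshGraph_adj hvM hxV hm'.symm)
      · exact Or.inr ⟨y, hy, hstep.reachable.trans hreach, hnear⟩
    · exact Or.inr ⟨u, hxV, SimpleGraph.Reachable.refl _, not_lt.1 hfar⟩

end Deterministic

/-! ### For all small meshes: the two discretisations of nested Jordan domains -/

/-- **The small discrete domain lies in the big one, for all small meshes.** For Jordan domains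
`D' ⊆ D`: eventually `Ω'_δ ⊆ Ω_δ` (both are the bulk component of a common deep ball). -/
theorem eventually_meshDomain_inner_subset (D D' : JordanDomain) (hsub : D'.carrier ⊆ D.carrier) :
    ∀ᶠ δ in 𝓝[>] (0 : ℝ), meshDomain D'.carrier δ ⊆ meshDomain D.carrier δ := by
  -- a closed ball inside the small domain
  obtain ⟨z₀, hz₀⟩ := D'.nonempty
  obtain ⟨r₀, hr₀, hball⟩ := Metric.isOpen_iff.1 D'.isOpen z₀ hz₀
  obtain ⟨r, hr, hK'⟩ : ∃ r : ℝ, 0 < r ∧ closedBall z₀ r ⊆ D'.carrier :=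
    ⟨r₀ / 2, by positivity, (closedBall_subset_ball (by linarith)).trans hball⟩
  have hK : closedBall z₀ r ⊆ D.carrier := hK'.trans hsub
  have hKc : IsCompact (closedBall z₀ r) := isCompact_closedBall _ _
  filter_upwards [D.eventually_forall_mem_meshDomain' hKc hK, D'.eventually_forall_mem_meshDomain' hKc hK',
    Ioo_mem_nhdsGT hr] with δ hD hD' hδ
  intro x hx
  -- the lattice point next to `z₀` is in both bulks
  set x₀ := nearestSite δ z₀ with hx₀
  have hx₀K : meshPoint δ x₀ ∈ closedBall z₀ r :=
    mem_closedBall.2 ((dist_meshPoint_nearestSite_le hδ.1 z₀).trans hδ.2.le)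
  have hx₀M : x₀ ∈ meshDomain D.carrier δ := hD.1 x₀ hx₀K
  have hx₀M' : x₀ ∈ meshDomain D'.carrier δ := hD'.1 x₀ hx₀K
  obtain ⟨hxV', hx₀V', hreach⟩ := hD'.2 x hx x₀ hx₀M'
  -- reachability in the small mesh graph gives reachability in the big one
  have hmap : ∀ {a b : meshVertices D'.carrier δ}, (meshVertexGraph D'.carrier δ).Reachable a b →
      (meshVertexGraph D.carrier δ).Reachable ⟨a, hsub (a.2 :)⟩ ⟨b, hsub (b.2 :)⟩ := by
    intro a b h
    obtain ⟨W⟩ := h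
    induction W with
    | nil => exact SimpleGraph.Reachable.refl _
    | @cons u v w huv W ih =>
      have hm : (meshGraph D'.carrier δ).Adj (u : Site 2) (v : Site 2) := huv
      have hm' : (meshGraph D.carrier δ).Adj (u : Site 2) (v : Site 2) :=
        meshGraph_adj_iff.2 ⟨(meshGraph_adj_iff.1 hm).1, (meshGraph_adj_iff.1 hm).2.trans (closure_mono hsub)⟩
      exact (SimpleGraph.Adj.reachable (show (meshVertexGraph D.carrier δ).Adj ⟨u, hsub (u.2 :)⟩
        ⟨v, hsub (v.2 :)⟩ from hm')).trans ih
  exact mem_meshDomain_of_reachable_meshVertexGraph hx₀M (hsub (hx₀V' :)) (hsub (hxV' :))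
    (hmap hreach).symm

/-- **Far sites of the big discrete domain lie in the small one, for all small meshes.** For
Jordan domains `D' ⊆ D` and `θ > 0`: eventually, every site of `Ω_δ` whose mesh point is at
distance `≥ θ` from `closure (D ∖ D')` lies in `Ω'_δ`. -/
theorem eventually_mem_inner_of_far (D D' : JordanDomain) (hsub : D'.carrier ⊆ D.carrier) {θ : ℝ}
    (hθ : 0 < θ) :
    ∀ᶠ δ in 𝓝[>] (0 : ℝ), ∀ x ∈ meshDomain D.carrier δ,
      θ ≤ infDist (meshPoint δ x) (closure (D.carrier \ D'.carrier)) → x ∈ meshDomain D'.carrier δ := by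
  -- a closed ball inside the small domain
  obtain ⟨z₀, hz₀⟩ := D'.nonempty
  obtain ⟨r₀, hr₀, hball⟩ := Metric.isOpen_iff.1 D'.isOpen z₀ hz₀
  obtain ⟨r, hr, hK'⟩ : ∃ r : ℝ, 0 < r ∧ closedBall z₀ r ⊆ D'.carrier :=
    ⟨r₀ / 2, by positivity, (closedBall_subset_ball (by linarith)).trans hball⟩
  have hK : closedBall z₀ r ⊆ D.carrier := hK'.trans hsub
  have hKc : IsCompact (closedBall z₀ r) := isCompact_closedBall _ _
  obtain ⟨δ₁, hδ₁, hbig⟩ := D'.exists_mem_meshDomain_of_reachable (half_pos hθ)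
  filter_upwards [D.eventually_forall_mem_meshDomain' hKc hK, D'.eventually_forall_mem_meshDomain' hKc hK',
    Ioo_mem_nhdsGT (lt_min hr (lt_min hδ₁ (half_pos hθ)))] with δ hD hD' hδ
  have hδr : δ < r := hδ.2.trans_le (min_le_left _ _)
  have hδ1 : δ < δ₁ := hδ.2.trans_le ((min_le_right _ _).trans (min_le_left _ _))
  have hδθ : δ < θ / 2 := hδ.2.trans_le ((min_le_right _ _).trans (min_le_right _ _))
  intro x hxM hxfar
  set x₀ := nearestSite δ z₀ with hx₀
  have hx₀K : meshPoint δ x₀ ∈ closedBall z₀ r :=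
    mem_closedBall.2 ((dist_meshPoint_nearestSite_le hδ.1 z₀).trans hδr.le)
  have hx₀M : x₀ ∈ meshDomain D.carrier δ := hD.1 x₀ hx₀K
  have hx₀M' : x₀ ∈ meshDomain D'.carrier δ := hD'.1 x₀ hx₀K
  obtain ⟨hxV, hx₀V, hreach⟩ := hD.2 x hxM x₀ hx₀M
  obtain ⟨W⟩ := hreach
  have hxV' : x ∈ meshVertices D'.carrier δ :=
    (mem_meshVertices_iff_of_far hsub (hθ.trans_le hxfar)).1 hxV
  rcases mem_or_exists_near_of_walk hsub hδ.1.le hx₀M' (x := ⟨x, hxV⟩) (y₀ := ⟨x₀, hx₀V⟩) rfl W hxV' with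
    h | ⟨y, hy, hreach', hnear⟩
  · exact h
  · -- `x` is far from the removed part, `y` is next to it: a macroscopic component
    refine hbig δ hδ.1 hδ1 ⟨x, hxV'⟩ ⟨y, hy⟩ hreach' ?_
    have := infDist_le_infDist_add_dist (s := closure (D.carrier \ D'.carrier)) (x := meshPoint δ x)
      (y := meshPoint δ y)
    show θ / 2 ≤ dist (meshPoint δ x) (meshPoint δ y)
    linarith

/-! ### Registered sub-goal (one-line signature, verbatim) -/

/-- **Registered sub-goal `stub_discreteLocality_lattice` of `stub_discreteLocality`**: far sites
of the big discrete domain lie in the small one, `eventually_mem_inner_of_far`, fully quantified. -/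
theorem stub_discreteLocality_lattice : ∀ (D D' : JordanDomain), D'.carrier ⊆ D.carrier → ∀ θ : ℝ, 0 < θ → ∀ᶠ δ in nhdsWithin (0 : ℝ) (Set.Ioi 0), ∀ x ∈ meshDomain D.carrier δ, θ ≤ Metric.infDist (meshPoint δ x) (closure (D.carrier \ D'.carrier)) → x ∈ meshDomain D'.carrier δ :=
  fun D D' hsub _ hθ => eventually_mem_inner_of_far D D' hsub hθ

end Summit.CriticalPhenomena.CardyFormulaZ2.Cruxes.LagHandOff.HittingTournament

end
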